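import Literature.AnabelianGeometry.EtaleTheta.GalSectThm110iiiTransport
import HarnessLib

/-!
# [GalSect] §4: functoriality of the torsor of splitting classes — the CLASS TRANSPORT along a
# pair-preserving isomorphism exists, is unique, bijective and functorial (proof-only)

S. Mochizuki, *Galois sections in absolute anabelian geometry* [GalSect], Nagoya Math. J. **179** (2005), §4
p.33 [cite: MochizukiGalSect2005, §4 p.33]; consumer: [EtTh] Thm. 1.10 (iii) / Cor. 2.8 (ii) "preserved by
`γ`" [cite: MochizukiEtTh2009, Thm 1.10 (iii) p.30].  abc-iut cell, layer L2, seat abc-iut-w5-d062 (gen 3),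
self-directed row «O1-(b2) at the genuine torsor», FILE (A).  PROOF-ONLY: no definitions, no named facts.

In `thm110iiiGalSect_of_transport` (`GalSectThm110iiiTransport.lean`, O1) the transport of splitting
classes along the (inner-corrected) extension `Γ` of `γ` enters as a BINDER: a map
`e : Cα.pair.SplittingClass → Cβ.pair.SplittingClass` together with `he : e [S] = [Γ S]`.  Here, for any
isomorphism of topological groups `Γ : G ≃ₜ* G'` carrying the cuspidal pair `P = (D, I)` onto `P'`
(`P.map Γ = P'`):

* `exists_classTransport` — such an `e` EXISTS (the quotient map of `S ↦ Γ(S)`; `I`-conjugate splittings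
  go to `I'`-conjugate ones);
* `classTransport_unique` — it is UNIQUE (classes have representatives), `classTransport_mk` computes it;
* `classTransport_injective` / `_surjective` / `_bijective` — it is a bijection (inverse = transport
  along `Γ.symm`, `map_symm_map`);
* `classTransport_id` / `classTransport_comp` — functoriality;
* `image_members_classTransport` — restatement of O1's members-level transport for THE transport.

So the datum `(e, he)` of O1 is THEOREM-SUPPLIED; what remains a binder there is only the equivariance of
`e` along `φ : (K_α^×)^∧ → (K_β^×)^∧` (FILE (B): proved for the genuine cohomological structure group) and
the correspondence of the canonical integral structures.  HONEST FRAMING: elementary group theory over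
[GalSect] §4 (refereed); nothing here bears on [IUTchIII] Cor. 3.12; typed ≠ proved for anything of [EtTh].
-/

namespace Literature.AnabelianGeometry.EtaleTheta

open scoped Pointwise

namespace GalSect

namespace CuspPair

variable {G G' G'' : Type*} [Group G] [TopologicalSpace G] [Group G'] [TopologicalSpace G']
  [Group G''] [TopologicalSpace G'']

/-! ### `map` is functorial -/

/-- `P.map (refl) = P`. [cite: MochizukiGalSect2005, §4 p.33] -/
theorem map_refl (P : CuspPair G) : P.map (ContinuousMulEquiv.refl G) = P := by
  refine ext' ?_ ?_
  · change P.D.map (MulEquiv.refl G).toMonoidHom = P.D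
    exact Subgroup.map_id P.D
  · change P.I.map (MulEquiv.refl G).toMonoidHom = P.I
    exact Subgroup.map_id P.I

/-- `P.map (Γ₁ ≫ Γ₂) = (P.map Γ₁).map Γ₂`. [cite: MochizukiGalSect2005, §4 p.33] -/
theorem map_trans (P : CuspPair G) (Γ₁ : G ≃ₜ* G') (Γ₂ : G' ≃ₜ* G'') :
    P.map (Γ₁.trans Γ₂) = (P.map Γ₁).map Γ₂ := by
  refine ext' ?_ ?_
  · change P.D.map _ = (P.D.map _).map _
    rw [Subgroup.map_map]
    rfl
  · change P.I.map _ = (P.I.map _).map _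
    rw [Subgroup.map_map]
    rfl

/-- Transport of a subgroup along `Γ` and back. [cite: MochizukiGalSect2005, §4 p.33] -/
theorem subgroup_map_symm_map (Γ : G ≃ₜ* G') (S : Subgroup G) :
    (S.map Γ.toMulEquiv.toMonoidHom).map Γ.symm.toMulEquiv.toMonoidHom = S := by
  ext x
  constructor
  · rintro ⟨_, ⟨y, hy, rfl⟩, rfl⟩
    change Γ.symm (Γ y) ∈ S
    rwa [ContinuousMulEquiv.symm_apply_apply]
  · intro hx
    exact ⟨Γ x, ⟨x, hx, rfl⟩, Γ.symm_apply_apply x⟩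

/-- Transport of a subgroup along `Γ.symm` and forth. [cite: MochizukiGalSect2005, §4 p.33] -/
theorem subgroup_map_map_symm (Γ : G ≃ₜ* G') (S' : Subgroup G') :
    (S'.map Γ.symm.toMulEquiv.toMonoidHom).map Γ.toMulEquiv.toMonoidHom = S' := by
  ext x
  constructor
  · rintro ⟨_, ⟨y, hy, rfl⟩, rfl⟩
    change Γ (Γ.symm y) ∈ S'
    rwa [ContinuousMulEquiv.apply_symm_apply]
  · intro hx
    exact ⟨Γ.symm x, ⟨x, hx, rfl⟩, Γ.apply_symm_apply x⟩

/-- `(P.map Γ).map Γ⁻¹ = P`. [cite: MochizukiGalSect2005, §4 p.33] -/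
theorem map_symm_map (P : CuspPair G) (Γ : G ≃ₜ* G') : (P.map Γ).map Γ.symm = P :=
  ext' (subgroup_map_symm_map Γ P.D) (subgroup_map_symm_map Γ P.I)

/-- `(P'.map Γ⁻¹).map Γ = P'`. [cite: MochizukiGalSect2005, §4 p.33] -/
theorem map_map_symm (P' : CuspPair G') (Γ : G ≃ₜ* G') : (P'.map Γ.symm).map Γ = P' :=
  ext' (subgroup_map_map_symm Γ P'.D) (subgroup_map_map_symm Γ P'.I)

/-- If `Γ` carries `P` onto `P'`, then `Γ⁻¹` carries `P'` onto `P`. [cite: MochizukiGalSect2005, §4 p.33] -/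
theorem map_symm_of_map_eq {P : CuspPair G} {P' : CuspPair G'} {Γ : G ≃ₜ* G'} (hpair : P.map Γ = P') :
    P'.map Γ.symm = P := by
  rw [← hpair, map_symm_map]

/-! ### Splittings and `I`-conjugacy under transport -/

/-- A subgroup is a splitting of `P` iff its `Γ`-image is a splitting of `Γ(P)`.
[cite: MochizukiGalSect2005, §4 p.33] -/
theorem map_mem_splittings_iff (P : CuspPair G) (Γ : G ≃ₜ* G') (S : Subgroup G) :
    S.map Γ.toMulEquiv.toMonoidHom ∈ (P.map Γ).splittings ↔ S ∈ P.splittings := by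
  refine ⟨fun h => ?_, P.map_mem_splittings Γ⟩
  have h' := (P.map Γ).map_mem_splittings Γ.symm h
  rwa [map_symm_map, subgroup_map_symm_map] at h'

/-- `I`-conjugacy is transported by `Γ`. [cite: MochizukiGalSect2005, §4 p.33] -/
theorem inertiaConj_map (P : CuspPair G) (Γ : G ≃ₜ* G') {S T : Subgroup G} (h : P.InertiaConj S T) :
    (P.map Γ).InertiaConj (S.map Γ.toMulEquiv.toMonoidHom) (T.map Γ.toMulEquiv.toMonoidHom) := by
  obtain ⟨i, hi, rfl⟩ := h
  exact ⟨Γ.toMulEquiv.toMonoidHom i, ⟨i, hi, rfl⟩, GalSect.map_conj_smul _ i S⟩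

/-- … in both directions. [cite: MochizukiGalSect2005, §4 p.33] -/
theorem inertiaConj_map_iff (P : CuspPair G) (Γ : G ≃ₜ* G') (S T : Subgroup G) :
    (P.map Γ).InertiaConj (S.map Γ.toMulEquiv.toMonoidHom) (T.map Γ.toMulEquiv.toMonoidHom) ↔
      P.InertiaConj S T := by
  refine ⟨fun h => ?_, P.inertiaConj_map Γ⟩
  have h' := (P.map Γ).inertiaConj_map Γ.symm h
  rwa [map_symm_map, subgroup_map_symm_map, subgroup_map_symm_map] at h'

/-! ### The class transport: existence, computation, uniqueness -/

/-- **Existence of the class transport** along a pair-preserving isomorphism: a map on splitting classes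
which is `S ↦ Γ(S)` on representatives (O1's binder `(e, he)`). [cite: MochizukiGalSect2005, §4 p.33] -/
theorem exists_classTransport {P : CuspPair G} {P' : CuspPair G'} (Γ : G ≃ₜ* G') (hpair : P.map Γ = P') :
    ∃ e : P.SplittingClass → P'.SplittingClass, ∀ (S : Subgroup G) (hS : S ∈ P.splittings),
      ∃ h', e (SplittingClass.mk P S hS) =
        SplittingClass.mk P' (S.map Γ.toMulEquiv.toMonoidHom) h' := by
  subst hpair
  refine ⟨Quotient.lift (fun S : P.splittings =>
      SplittingClass.mk (P.map Γ) (S.1.map Γ.toMulEquiv.toMonoidHom) (P.map_mem_splittings Γ S.2))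
    (fun S T hST => (SplittingClass.mk_eq_mk_iff _ _).2 (P.inertiaConj_map Γ hST)), ?_⟩
  intro S hS
  exact ⟨P.map_mem_splittings Γ hS, rfl⟩

section Transport

variable {P : CuspPair G} {P' : CuspPair G'} {Γ : G ≃ₜ* G'}
  {e : P.SplittingClass → P'.SplittingClass}

/-- The value of a class transport on a class, for ANY admissible proof of membership.
[cite: MochizukiGalSect2005, §4 p.33] -/
theorem classTransport_mk
    (he : ∀ (S : Subgroup G) (hS : S ∈ P.splittings),
      ∃ h', e (SplittingClass.mk P S hS) = SplittingClass.mk P' (S.map Γ.toMulEquiv.toMonoidHom) h')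
    (S : Subgroup G) (hS : S ∈ P.splittings) (h' : S.map Γ.toMulEquiv.toMonoidHom ∈ P'.splittings) :
    e (SplittingClass.mk P S hS) = SplittingClass.mk P' (S.map Γ.toMulEquiv.toMonoidHom) h' := by
  obtain ⟨h'', h⟩ := he S hS
  exact h

/-- **Uniqueness of the class transport**: two maps which are `S ↦ Γ(S)` on representatives coincide.
[cite: MochizukiGalSect2005, §4 p.33] -/
theorem classTransport_unique {e₁ e₂ : P.SplittingClass → P'.SplittingClass}
    (he₁ : ∀ (S : Subgroup G) (hS : S ∈ P.splittings),
      ∃ h', e₁ (SplittingClass.mk P S hS) = SplittingClass.mk P' (S.map Γ.toMulEquiv.toMonoidHom) h')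
    (he₂ : ∀ (S : Subgroup G) (hS : S ∈ P.splittings),
      ∃ h', e₂ (SplittingClass.mk P S hS) = SplittingClass.mk P' (S.map Γ.toMulEquiv.toMonoidHom) h') :
    e₁ = e₂ := by
  funext c
  obtain ⟨S, hS, rfl⟩ := SplittingClass.exists_rep P c
  obtain ⟨h₁, h₁'⟩ := he₁ S hS
  rw [h₁', classTransport_mk he₂ S hS h₁]

/-- The identity is the class transport along `Γ = id` (so O1's reflexive case is an instance).
[cite: MochizukiGalSect2005, §4 p.33] -/
theorem classTransport_id (P : CuspPair G) (S : Subgroup G) (hS : S ∈ P.splittings) :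
    ∃ h', id (SplittingClass.mk P S hS) =
      SplittingClass.mk P (S.map (ContinuousMulEquiv.refl G).toMulEquiv.toMonoidHom) h' := by
  have hmap : S.map (ContinuousMulEquiv.refl G).toMulEquiv.toMonoidHom = S := Subgroup.map_id S
  refine ⟨by rw [hmap]; exact hS, ?_⟩
  exact (SplittingClass.mk_eq_mk_iff hS _).2 ⟨1, P.I.one_mem, by rw [map_one, one_smul, hmap]⟩

/-- **Composition**: transports along `Γ₁` and `Γ₂` compose to the transport along `Γ₁ ≫ Γ₂`.
[cite: MochizukiGalSect2005, §4 p.33] -/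
theorem classTransport_comp {P'' : CuspPair G''} {Γ₂ : G' ≃ₜ* G''}
    {e₂ : P'.SplittingClass → P''.SplittingClass}
    (he : ∀ (S : Subgroup G) (hS : S ∈ P.splittings),
      ∃ h', e (SplittingClass.mk P S hS) = SplittingClass.mk P' (S.map Γ.toMulEquiv.toMonoidHom) h')
    (he₂ : ∀ (S' : Subgroup G') (hS' : S' ∈ P'.splittings),
      ∃ h', e₂ (SplittingClass.mk P' S' hS') = SplittingClass.mk P'' (S'.map Γ₂.toMulEquiv.toMonoidHom) h')
    (S : Subgroup G) (hS : S ∈ P.splittings) :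
    ∃ h', (e₂ ∘ e) (SplittingClass.mk P S hS) =
      SplittingClass.mk P'' (S.map (Γ.trans Γ₂).toMulEquiv.toMonoidHom) h' := by
  obtain ⟨h₁, he₁⟩ := he S hS
  obtain ⟨h₂, he₂'⟩ := he₂ _ h₁
  have hmm : (S.map Γ.toMulEquiv.toMonoidHom).map Γ₂.toMulEquiv.toMonoidHom =
      S.map (Γ.trans Γ₂).toMulEquiv.toMonoidHom := by
    rw [Subgroup.map_map]
    rfl
  refine ⟨hmm ▸ h₂, ?_⟩
  rw [Function.comp_apply, he₁, he₂']
  exact (SplittingClass.mk_eq_mk_iff h₂ _).2 ⟨1, P''.I.one_mem, by rw [map_one, one_smul, hmm]⟩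

/-- **Injectivity** of the class transport (pair-preserving `Γ`). [cite: MochizukiGalSect2005, §4 p.33] -/
theorem classTransport_injective (hpair : P.map Γ = P')
    (he : ∀ (S : Subgroup G) (hS : S ∈ P.splittings),
      ∃ h', e (SplittingClass.mk P S hS) = SplittingClass.mk P' (S.map Γ.toMulEquiv.toMonoidHom) h') :
    Function.Injective e := by
  subst hpair
  intro c₁ c₂ h
  obtain ⟨S₁, hS₁, rfl⟩ := SplittingClass.exists_rep P c₁
  obtain ⟨S₂, hS₂, rfl⟩ := SplittingClass.exists_rep P c₂
  obtain ⟨h₁, he₁⟩ := he S₁ hS₁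
  obtain ⟨h₂, he₂⟩ := he S₂ hS₂
  rw [he₁, he₂, SplittingClass.mk_eq_mk_iff] at h
  exact (SplittingClass.mk_eq_mk_iff hS₁ hS₂).2 ((P.inertiaConj_map_iff Γ S₁ S₂).1 h)

/-- **Surjectivity** of the class transport (pair-preserving `Γ`): the class of `S'` is hit by the class of
`Γ⁻¹(S')`. [cite: MochizukiGalSect2005, §4 p.33] -/
theorem classTransport_surjective (hpair : P.map Γ = P')
    (he : ∀ (S : Subgroup G) (hS : S ∈ P.splittings),
      ∃ h', e (SplittingClass.mk P S hS) = SplittingClass.mk P' (S.map Γ.toMulEquiv.toMonoidHom) h') :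
    Function.Surjective e := by
  intro c'
  obtain ⟨S', hS', rfl⟩ := SplittingClass.exists_rep P' c'
  have hS : S'.map Γ.symm.toMulEquiv.toMonoidHom ∈ P.splittings := by
    rw [← map_symm_of_map_eq hpair]
    exact P'.map_mem_splittings Γ.symm hS'
  refine ⟨SplittingClass.mk P _ hS, ?_⟩
  have h' : (S'.map Γ.symm.toMulEquiv.toMonoidHom).map Γ.toMulEquiv.toMonoidHom ∈ P'.splittings := by
    rw [subgroup_map_map_symm]; exact hS'
  rw [classTransport_mk he _ hS h']
  exact (SplittingClass.mk_eq_mk_iff h' hS').2 ⟨1, P'.I.one_mem, by rw [map_one, one_smul,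
    subgroup_map_map_symm]⟩

/-- **Bijectivity** of the class transport. [cite: MochizukiGalSect2005, §4 p.33] -/
theorem classTransport_bijective (hpair : P.map Γ = P')
    (he : ∀ (S : Subgroup G) (hS : S ∈ P.splittings),
      ∃ h', e (SplittingClass.mk P S hS) = SplittingClass.mk P' (S.map Γ.toMulEquiv.toMonoidHom) h') :
    Function.Bijective e :=
  ⟨classTransport_injective hpair he, classTransport_surjective hpair he⟩

/-- The transport along `Γ⁻¹` inverts the transport along `Γ` (left inverse).
[cite: MochizukiGalSect2005, §4 p.33] -/
theorem classTransport_symm_apply {e' : P'.SplittingClass → P.SplittingClass}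
    (he : ∀ (S : Subgroup G) (hS : S ∈ P.splittings),
      ∃ h', e (SplittingClass.mk P S hS) = SplittingClass.mk P' (S.map Γ.toMulEquiv.toMonoidHom) h')
    (he' : ∀ (S' : Subgroup G') (hS' : S' ∈ P'.splittings),
      ∃ h', e' (SplittingClass.mk P' S' hS') =
        SplittingClass.mk P (S'.map Γ.symm.toMulEquiv.toMonoidHom) h')
    (c : P.SplittingClass) : e' (e c) = c := by
  obtain ⟨S, hS, rfl⟩ := SplittingClass.exists_rep P c
  obtain ⟨h₁, he₁⟩ := he S hS
  have h₂ : (S.map Γ.toMulEquiv.toMonoidHom).map Γ.symm.toMulEquiv.toMonoidHom ∈ P.splittings := by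
    rw [subgroup_map_symm_map]; exact hS
  rw [he₁, classTransport_mk he' _ h₁ h₂]
  exact (SplittingClass.mk_eq_mk_iff h₂ hS).2 ⟨1, P.I.one_mem, by rw [map_one, one_smul,
    subgroup_map_symm_map]⟩

/-! ### Consequences for "preserved by `γ`" -/

/-- **Members-level transport for THE class transport** (O1's `image_members_eq_members_image`, with the
datum now theorem-supplied): the `Γ`-images of the member splittings of `R` are the member splittings
of `e '' R`. [cite: MochizukiEtTh2009, Thm 1.10 (iii) p.30] -/
theorem image_members_classTransport [IsTopologicalGroup G] (hpair : P.map Γ = P')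
    (he : ∀ (S : Subgroup G) (hS : S ∈ P.splittings),
      ∃ h', e (SplittingClass.mk P S hS) = SplittingClass.mk P' (S.map Γ.toMulEquiv.toMonoidHom) h')
    (R : Set P.SplittingClass) :
    (fun S => S.map Γ.toMulEquiv.toMonoidHom) '' P.members R = P'.members (e '' R) :=
  image_members_eq_members_image Γ hpair e he R

/-- Hence `Γ` PRESERVES the pair of structures `(R, e '' R)` for every set of classes `R` — "preserved by
`γ`" holds for a structure and its transported structure. [cite: MochizukiEtTh2009, Thm 1.10 (iii) p.30] -/
theorem preservedBy_image_classTransport [IsTopologicalGroup G] (hpair : P.map Γ = P')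
    (he : ∀ (S : Subgroup G) (hS : S ∈ P.splittings),
      ∃ h', e (SplittingClass.mk P S hS) = SplittingClass.mk P' (S.map Γ.toMulEquiv.toMonoidHom) h')
    (R : Set P.SplittingClass) :
    P.PreservedBy P' Γ R (e '' R) :=
  ⟨congrArg CuspPair.D hpair, image_members_classTransport hpair he R⟩

/-- Conversely, "preserved by `γ`" DETERMINES the target structure: if `Γ` carries the members of `R`
onto the members of `R'`, then `R' = e '' R`. [cite: MochizukiEtTh2009, Thm 1.10 (iii) p.30] -/
theorem PreservedBy.eq_image_classTransport [IsTopologicalGroup G] (hpair : P.map Γ = P')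
    (he : ∀ (S : Subgroup G) (hS : S ∈ P.splittings),
      ∃ h', e (SplittingClass.mk P S hS) = SplittingClass.mk P' (S.map Γ.toMulEquiv.toMonoidHom) h')
    {R : Set P.SplittingClass} {R' : Set P'.SplittingClass} (h : P.PreservedBy P' Γ R R') :
    R' = e '' R := by
  have hmem : P'.members R' = P'.members (e '' R) := by
    rw [← h.2, image_members_classTransport hpair he]
  ext c'
  obtain ⟨S', hS', rfl⟩ := SplittingClass.exists_rep P' c'
  constructor
  · intro hc
    have : S' ∈ P'.members (e '' R) := by rw [← hmem]; exact ⟨hS', hc⟩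
    obtain ⟨hS'', hR⟩ := this
    exact hR
  · intro hc
    have : S' ∈ P'.members R' := by rw [hmem]; exact ⟨hS', hc⟩
    obtain ⟨hS'', hR⟩ := this
    exact hR

/-- So, for a pair-preserving `Γ`, "there is a structure `R'` at the image cusp onto which `Γ` carries
`R`" is ALWAYS true (`R' := e '' R`), and `R'` is unique. [cite: MochizukiEtTh2009, Thm 1.10 (iii) p.30] -/
theorem existsUnique_preservedBy [IsTopologicalGroup G] (hpair : P.map Γ = P')
    (R : Set P.SplittingClass) : ∃! R' : Set P'.SplittingClass, P.PreservedBy P' Γ R R' := by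
  obtain ⟨e₀, he₀⟩ := exists_classTransport Γ hpair
  exact ⟨e₀ '' R, preservedBy_image_classTransport hpair he₀ R,
    fun R' hR' => hR'.eq_image_classTransport hpair he₀⟩

end Transport

end CuspPair

end GalSect

end Literature.AnabelianGeometry.EtaleTheta
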